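import Literature.MathematicalPhysics.QuantumLattice.ErgodicStatesODLROProofs
import Literature.MathematicalPhysics.QuantumLattice.TIGroundStatePairLROCeiling
import HarnessLib

/-!
# The pair-LRO ceiling holds for ERGODIC ground states: in the ergodic class, LRO = |pair amplitude|²

Topic `Literature/MathematicalPhysics/QuantumLattice` (namespace = path; family `hubbard`, cell `hubbard-cq`,
seat `hubbard-cq-lit-1` g4). Companion of `TIGroundStatePairLROCeiling.lean` (the named, UNPROVED ceiling
`TIGroundStatePairLROCeiling t' U μ`: every translation-invariant ground state `ω` of the pair-sourced `t–t'`
Hubbard interaction `Ψ_h`, `h ≥ 0`, has `limsup_N boxLRO_N(ω) ≤ (∂⁺E(h)/2)²`) and of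
`ErgodicStatesODLROProofs.lean` (Bratteli–Robinson I Thm. 4.3.17 for the lattice fermions: an ERGODIC state has
`boxLRO_N(ω) → |ω(P₀)|²`). Everything here is PROVED; no definition, no named fact.

Notation: `E = dWaveSourceEnergyDensityTT' t' U μ`, `Ψ_h = hubbardTTPrimeSourcedInteraction 1 t' U μ dWaveFormFactor h`
(`Ψ_0 = hubbardTTPrimeMuInteraction 1 t' U μ`), `m⋆ = dWaveOrderParameterTT' t' U μ = −∂⁺E(0)/2`,
`P₀ = localPairAt ({0} ∪ unitSteps) dWaveFormFactor 0`, `boxLRO_N(ω) = Re N⁻⁴ Σ_{x,y∈[0,N)²} ω(P_x⋆ P_y)`.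

* `IsMeanEnergyMinimiser.norm_expect_localPairAt_eq_re` — **phase alignment**: at `h > 0` every translation-invariant
  ground state of `Ψ_h` has `|ω(P₀)| = Re ω(P₀)` (a gauge rotation `γ_θ` making the amplitude real non-negative is a
  translation-invariant competitor with mean energy `… − 2h|ω(P₀)| ≤ … − 2h Re ω(P₀)`; Koma–Tasaki 1994 §1, the
  order parameter is attained at real positive source).
* `IsErgodic.tendsto_re_boxAverage_dWavePairCorr` — for an ergodic state, `boxLRO_N(ω) → |ω(P₀)|²`
  (the `d`-wave case of `ergodic_pairCorr_boxAverage_holds`).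
* **`tIGroundStatePairLROCeiling_of_isErgodic`** — THE CEILING FOR ERGODIC GROUND STATES: for `h ≥ 0` and every
  translation-ERGODIC ground state `ω` of `Ψ_h`, `∀ ε > 0`, eventually `boxLRO_N(ω) ≤ (∂⁺E(h)/2)² + ε`. At `h = 0`:
  `boxLRO_N(ω) → |ω(P₀)|² ≤ (m⋆)²` (`|ω(P₀)| ≤ m⋆`, `DWaveSymmetricGroundStateLRO.lean`); at `h > 0`: `boxLRO_N(ω) → (Re ω(P₀))² ≤ (∂⁺E(h)/2)²`
  (Griffiths bracket `2 Re ω(P₀) ≤ −∂⁺E(h)`). So the named ceiling holds at every EXTREMAL point of the face of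
  ground states (`IsMeanEnergyMinimiser.isErgodic_of_extremal`); what remains of `TIGroundStatePairLROCeiling` is the
  passage to non-ergodic ground states (an ergodic-decomposition / Bauer-maximum-principle statement on
  `InfVolFermionState`, not available in the tree — recorded, not claimed).
* `IsErgodic.zeroFieldPairLROCeiling` (the `h = 0` form), `IsErgodic.pairLROCeiling_of_pos` (the `h > 0` form),
  and `IsErgodic.tendsto_re_boxAverage_dWavePairCorr_of_norm_eq`: an ergodic state with `|ω(P₀)| = m⋆` (the
  boundary circle of the disc `{ω(P₀)} = closedBall 0 m⋆` of `image_expect_localPairAt_groundStates_eq_closedBall`)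
  has `boxLRO_N(ω) → (m⋆)²`, i.e. saturates the ceiling — in the ergodic class «LRO word = response word squared»
  exactly (two-sided for ergodic states).

HONEST SCOPE: T5-class statements about INFINITE-VOLUME translation-invariant (ergodic) ground states; direction and
content as printed (Koma–Tasaki: order parameter ⇒ bound on the LRO of ground states); no bearing on torus ground
states, no number, no CQ row, nothing here floors `d`-wave order.

## References
* O. Bratteli, D. W. Robinson, *Operator Algebras and Quantum Statistical Mechanics 1*, 2nd ed. (1987), §4.3.1,
  Thm. 4.3.17 (PDF p. 395). [cite: BratteliRobinsonI1987, Thm. 4.3.17]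
* T. Koma, H. Tasaki, Commun. Math. Phys. 158 (1993) 191, Thm. 7.3. [cite: KomaTasaki1993, Theorem 7.3]
* T. Koma, H. Tasaki, J. Stat. Phys. 76 (1994) 745, §1 and §2.5. [cite: KomaTasaki1994, §1]
* R. B. Griffiths, Phys. Rev. 152 (1966) 240, §II. [cite: Griffiths1966, §II]
-/

noncomputable section

namespace Literature.MathematicalPhysics.QuantumLattice

open _root_.Matrix Finset Complex Literature.Probability.LatticeModels _root_.Filter Set
open scoped _root_.Topology ComplexOrder

namespace InfVolFermionState

/-! ### Phase alignment of the pair amplitude of a sourced ground state -/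

/-- **At `h > 0` the pair amplitude of every translation-invariant ground state is real and non-negative,
`|ω(P₀)| = Re ω(P₀)`**: the gauge rotation `ω ∘ γ_θ`, `θ = arg ω(P₀)/2`, is translation invariant, has the same
`t–t'–U–μ` mean energy and pair amplitude `e^{-2iθ} ω(P₀) = |ω(P₀)|`, hence mean energy
`e₀ − 2h|ω(P₀)| ≥ e₀ − 2h Re ω(P₀)` by minimality. [cite: KomaTasaki1994, §1] -/
theorem IsMeanEnergyMinimiser.norm_expect_localPairAt_eq_re {t' U μ h : ℝ} (hh : 0 < h)
    {ω : InfVolFermionState 2}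
    (hω : ω.IsMeanEnergyMinimiser (hubbardTTPrimeSourcedInteraction 1 t' U μ dWaveFormFactor h) 1) :
    ‖ω.expect (pairRegion (insert (0 : Site 2) unitSteps) 0)
        (localPairAt (insert 0 unitSteps) dWaveFormFactor 0)‖ =
      (ω.expect (pairRegion (insert (0 : Site 2) unitSteps) 0)
        (localPairAt (insert 0 unitSteps) dWaveFormFactor 0)).re := by
  set a : ℂ := ω.expect (pairRegion (insert (0 : Site 2) unitSteps) 0)
    (localPairAt (insert 0 unitSteps) dWaveFormFactor 0) with ha
  set θ : ℝ := Complex.arg a / 2 with hθ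
  -- the rotated amplitude is `|a|`
  have hphase : exp (-(2 * (I * (θ : ℂ)))) * a = (‖a‖ : ℂ) := by
    have h1 : (‖a‖ : ℂ) * exp (Complex.arg a * I) = a := Complex.norm_mul_exp_arg_mul_I a
    have h2 : -(2 * (I * (θ : ℂ))) = -(Complex.arg a * I) := by
      rw [hθ]; push_cast; ring
    rw [h2]
    calc exp (-(Complex.arg a * I)) * a
        = exp (-(Complex.arg a * I)) * ((‖a‖ : ℂ) * exp (Complex.arg a * I)) := by rw [h1]
      _ = (‖a‖ : ℂ) * (exp (-(Complex.arg a * I)) * exp (Complex.arg a * I)) := by ring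
      _ = (‖a‖ : ℂ) := by rw [← Complex.exp_add, neg_add_cancel, Complex.exp_zero, mul_one]
  -- minimality against the rotated state
  have hTI' : (ω.gaugeShift θ).IsTranslationInvariant := hω.1.gaugeShift θ
  have hmin := hω.2 _ hTI'
  rw [hubbardTTPrimeSourcedInteraction, meanEnergy_pencil, meanEnergy_pencil,
    meanEnergy_gaugeShift _ (hubbardTTPrimeMuInteraction_isGaugeInvariant 1 t' U μ),
    meanEnergy_pairSourceInteraction_dWave_eq, meanEnergy_pairSourceInteraction_dWave_eq,
    gaugeShift_expect_localPairAt, ← ha, hphase, Complex.ofReal_re] at hmin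
  have hle : ‖a‖ ≤ a.re := by nlinarith
  exact le_antisymm hle (Complex.re_le_norm a)

/-- At `h > 0` the pair amplitude of a translation-invariant ground state has vanishing imaginary part.
[cite: KomaTasaki1994, §1] -/
theorem IsMeanEnergyMinimiser.im_expect_localPairAt_eq_zero {t' U μ h : ℝ} (hh : 0 < h)
    {ω : InfVolFermionState 2}
    (hω : ω.IsMeanEnergyMinimiser (hubbardTTPrimeSourcedInteraction 1 t' U μ dWaveFormFactor h) 1) :
    (ω.expect (pairRegion (insert (0 : Site 2) unitSteps) 0)
        (localPairAt (insert 0 unitSteps) dWaveFormFactor 0)).im = 0 := by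
  have h := hω.norm_expect_localPairAt_eq_re hh
  set a : ℂ := ω.expect (pairRegion (insert (0 : Site 2) unitSteps) 0)
    (localPairAt (insert 0 unitSteps) dWaveFormFactor 0)
  have hsq : ‖a‖ ^ 2 = a.re ^ 2 + a.im ^ 2 := by
    rw [Complex.sq_norm, Complex.normSq_apply]; ring
  rw [h] at hsq
  nlinarith [sq_nonneg a.im]

/-! ### Ergodic states: the box pair LRO converges to `|ω(P₀)|²` -/

/-- **For an ergodic state `boxLRO_N(ω) → |ω(P₀^d)|²`** (the `d`-wave instance of
`ergodic_pairCorr_boxAverage_holds`, real parts). [cite: BratteliRobinsonI1987, Thm. 4.3.17] -/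
theorem IsErgodic.tendsto_re_boxAverage_dWavePairCorr {ω : InfVolFermionState 2} (herg : ω.IsErgodic) :
    Tendsto (fun N : ℕ => (((N : ℂ) ^ 4)⁻¹ *
        ∑ x ∈ halfOpenBox 2 N, ∑ y ∈ halfOpenBox 2 N, ω.dWavePairCorr x y).re) atTop
      (𝓝 (‖ω.expect (pairRegion (insert (0 : Site 2) unitSteps) 0)
        (localPairAt (insert 0 unitSteps) dWaveFormFactor 0)‖ ^ 2)) := by
  have h := (Complex.continuous_re.tendsto _).comp
    (herg.tendsto_pairCorr_boxAverage (insert 0 unitSteps) dWaveFormFactor)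
  rw [Function.comp_def, Complex.ofReal_re] at h
  exact h

/-! ### The ceiling for ergodic ground states -/

/-- **Zero field: every ERGODIC translation-invariant ground state obeys the pair-LRO ceiling `(m⋆)²`**:
`boxLRO_N(ω) → |ω(P₀)|² ≤ (m⋆)²`. [cite: KomaTasaki1993, Theorem 7.3] -/
theorem IsErgodic.zeroFieldPairLROCeiling {t' U μ : ℝ} {ω : InfVolFermionState 2} (herg : ω.IsErgodic)
    (hω : ω.IsMeanEnergyMinimiser (hubbardTTPrimeMuInteraction 1 t' U μ) 1) (ε : ℝ) (hε : 0 < ε) :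
    ∀ᶠ N : ℕ in atTop,
      (((N : ℂ) ^ 4)⁻¹ * ∑ x ∈ halfOpenBox 2 N, ∑ y ∈ halfOpenBox 2 N, ω.dWavePairCorr x y).re ≤
        dWaveOrderParameterTT' t' U μ ^ 2 + ε := by
  have hlim := herg.tendsto_re_boxAverage_dWavePairCorr
  have hle : ‖ω.expect (pairRegion (insert (0 : Site 2) unitSteps) 0)
      (localPairAt (insert 0 unitSteps) dWaveFormFactor 0)‖ ^ 2 ≤ dWaveOrderParameterTT' t' U μ ^ 2 :=
    pow_le_pow_left₀ (norm_nonneg _) (hω.norm_expect_localPairAt_le_dWaveOrderParameterTT' t' U μ) 2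
  filter_upwards [hlim.eventually (Iic_mem_nhds (lt_add_of_le_of_pos hle hε))] with N hN
  exact hN

/-- **Positive field: every ERGODIC translation-invariant ground state of `Ψ_h`, `h > 0`, obeys the pair-LRO
ceiling `(∂⁺E(h)/2)²`**: `boxLRO_N(ω) → |ω(P₀)|² = (Re ω(P₀))²` and `0 ≤ 2 Re ω(P₀) ≤ −∂⁺E(h)`.
[cite: KomaTasaki1993, Theorem 7.3] -/
theorem IsErgodic.pairLROCeiling_of_pos {t' U μ h : ℝ} (hh : 0 < h) {ω : InfVolFermionState 2}
    (herg : ω.IsErgodic)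
    (hω : ω.IsMeanEnergyMinimiser (hubbardTTPrimeSourcedInteraction 1 t' U μ dWaveFormFactor h) 1)
    (ε : ℝ) (hε : 0 < ε) :
    ∀ᶠ N : ℕ in atTop,
      (((N : ℂ) ^ 4)⁻¹ * ∑ x ∈ halfOpenBox 2 N, ∑ y ∈ halfOpenBox 2 N, ω.dWavePairCorr x y).re ≤
        (derivWithin (dWaveSourceEnergyDensityTT' t' U μ) (Ioi h) h / 2) ^ 2 + ε := by
  have hlim := herg.tendsto_re_boxAverage_dWavePairCorr
  have hre := hω.norm_expect_localPairAt_eq_re hh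
  have hnn := hω.re_expect_localPairAt_nonneg hh
  have hup := hω.two_mul_re_expect_localPairAt_mem_Icc.2
  have hle : ‖ω.expect (pairRegion (insert (0 : Site 2) unitSteps) 0)
      (localPairAt (insert 0 unitSteps) dWaveFormFactor 0)‖ ^ 2 ≤
        (derivWithin (dWaveSourceEnergyDensityTT' t' U μ) (Ioi h) h / 2) ^ 2 := by
    rw [hre]
    nlinarith
  filter_upwards [hlim.eventually (Iic_mem_nhds (lt_add_of_le_of_pos hle hε))] with N hN
  exact hN

/-- **`TIGroundStatePairLROCeiling` HOLDS ON ERGODIC GROUND STATES** (the named ceiling of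
`TIGroundStatePairLROCeiling.lean`, restricted to translation-ERGODIC `ω`; at `h = 0` via `m⋆ = −∂⁺E(0)/2`).
What is NOT proved: the passage to non-ergodic (non-extremal) ground states, which needs an ergodic decomposition
of translation-invariant states on `InfVolFermionState` (not in the tree).
[cite: KomaTasaki1993, Theorem 7.3] -/
theorem tIGroundStatePairLROCeiling_of_isErgodic (t' U μ : ℝ) :
    ∀ ⦃h : ℝ⦄, 0 ≤ h → ∀ ⦃ω : InfVolFermionState 2⦄, ω.IsErgodic →
      ω.IsMeanEnergyMinimiser (hubbardTTPrimeSourcedInteraction 1 t' U μ dWaveFormFactor h) 1 →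
      ∀ ε : ℝ, 0 < ε → ∀ᶠ N : ℕ in atTop,
        (((N : ℂ) ^ 4)⁻¹ * ∑ x ∈ halfOpenBox 2 N, ∑ y ∈ halfOpenBox 2 N, ω.dWavePairCorr x y).re ≤
          (derivWithin (dWaveSourceEnergyDensityTT' t' U μ) (Ioi h) h / 2) ^ 2 + ε := by
  intro h hh ω herg hω ε hε
  rcases eq_or_lt_of_le hh with rfl | hpos
  · have hω0 : ω.IsMeanEnergyMinimiser (hubbardTTPrimeMuInteraction 1 t' U μ) 1 := by
      rwa [hubbardTTPrimeSourcedInteraction_zero_source] at hω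
    have hsq : (derivWithin (dWaveSourceEnergyDensityTT' t' U μ) (Ioi 0) 0 / 2) ^ 2 =
        dWaveOrderParameterTT' t' U μ ^ 2 := by
      rw [dWaveOrderParameterTT'_eq_neg_half_rightDeriv]; ring
    rw [hsq]
    exact herg.zeroFieldPairLROCeiling hω0 ε hε
  · exact herg.pairLROCeiling_of_pos hpos hω ε hε

/-- **The ceiling is attained exactly by the ergodic ground states with maximal amplitude**: an ERGODIC
translation-invariant ground state of the zero-field interaction with `|ω(P₀)| = m⋆` (the boundary of the disc
`{ω(P₀)} = closedBall 0 m⋆` of `image_expect_localPairAt_groundStates_eq_closedBall`) has `boxLRO_N(ω) → (m⋆)²` —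
in the ergodic class the LRO word IS the response word squared. [cite: KomaTasaki1994, §1] -/
theorem IsErgodic.tendsto_re_boxAverage_dWavePairCorr_of_norm_eq {t' U μ : ℝ} {ω : InfVolFermionState 2}
    (herg : ω.IsErgodic)
    (hnorm : ‖ω.expect (pairRegion (insert (0 : Site 2) unitSteps) 0)
      (localPairAt (insert 0 unitSteps) dWaveFormFactor 0)‖ = dWaveOrderParameterTT' t' U μ) :
    Tendsto (fun N : ℕ => (((N : ℂ) ^ 4)⁻¹ *
        ∑ x ∈ halfOpenBox 2 N, ∑ y ∈ halfOpenBox 2 N, ω.dWavePairCorr x y).re) atTop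
      (𝓝 (dWaveOrderParameterTT' t' U μ ^ 2)) := by
  rw [← hnorm]
  exact herg.tendsto_re_boxAverage_dWavePairCorr

end InfVolFermionState

end Literature.MathematicalPhysics.QuantumLattice

end
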